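import Summits.CriticalPhenomena.PercolationContinuityZ3.Theorems.PercNearOneGluingNoHeavyLowerTailStarSetOmegaStar
import Summits.CriticalPhenomena.PercolationContinuityZ3.Theorems.PercNearOneGluingNoHeavyLowerTailStarSetForestCertificateTools
import HarnessLib

/-!
# `NoHeavyLowerTail` (stmt-CriticalPhenomena-4575) — load and capacity of a triangle word (rule A0 of U1-PROOF.md, blueprint B5a)

Support file (prover `prim-gen-swap` gen 13; `--supports stmt-CriticalPhenomena-4575`).  No definitions, no named facts, no sorries.

Rule A0 of the seat memo U1-PROOF.md §3 (LEAN-BLUEPRINT-U1.md §C (A0)): every unit of a configuration `S` containing a triangle `Δ` (classes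
`X₁, X₂, X₃` with port pairs `ab, ac, bc`) is charged to the balanced pair of rotations of `Δ`.  Load: the units of `S` are among its Ω-chords,
which are adjacent to the three sides, hence sides (`card_adjacent_triangle_le_three`), so
`Σ_{S ⊇ Δ} W(S)·n(S) ≤ 3·Π_{Δ} θ` (`cylinder_sum`).  Capacity: the two rotations are complementary on every class, so by AM–GM and the
class-odds bounds `O_{X,P}O_{X,P'} ≥ Φ_X²`, `Φ_X ≥ 4θ_X` their total mass is `≥ 2Φ₁Φ₂Φ₃ ≥ 128 θ₁θ₂θ₃`; the A0-load is at most `3/128` of it.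

* `StarSet.triangle_config_load_le` — `Σ_S W(S)·[Δ ⊆ S]·#{X ∈ S ∩ Cr adjacent to all of S} ≤ 3 Π_{Δ} θ`;
* `StarSet.two_mul_le_add_of_sq_le_mul` — `p² ≤ xy`, `x, y ≥ 0` ⇒ `2p ≤ x + y`;
* `StarSet.triangle_word_cap_ge` — `128 θ₁θ₂θ₃ ≤ O₁O₂O₃(rotation 1) + O₁O₂O₃(rotation 2)`.
-/

namespace Summit.CriticalPhenomena.PercolationContinuityZ3.Theorems

open Finset
open scoped BigOperators

namespace StarSet

variable {ι V : Type*} [Fintype ι] [DecidableEq ι] [DecidableEq V]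

/-- **A0 load (U1-PROOF §3): `Σ_S W(S)·[Δ ⊆ S]·#Ω(S) ≤ 3·Π_Δ θ`** when `Δ` contains three classes `X₁, X₂, X₃` with port pairs `ab, ac, bc`
(`a, b, c` distinct) and port pairs are pairwise distinct: every class of `S` adjacent to all of `S ⊇ Δ` is a side of the triangle. -/
theorem triangle_config_load_le (θ : ι → ℝ) (hθ0 : ∀ i, 0 ≤ θ i) (hθ1 : ∀ i, θ i ≤ 1)
    (P P' : ι → V) (hPP' : ∀ X, P X ≠ P' X) (hinj : Function.Injective fun X => (s(P X, P' X) : Sym2 V))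
    (Cr Δ : Finset ι) {a b c : V} (hab : a ≠ b) (hac : a ≠ c) (hbc : b ≠ c) {X₁ X₂ X₃ : ι}
    (h₁ : X₁ ∈ Δ) (h₂ : X₂ ∈ Δ) (h₃ : X₃ ∈ Δ) (hs₁ : (s(P X₁, P' X₁) : Sym2 V) = s(a, b))
    (hs₂ : (s(P X₂, P' X₂) : Sym2 V) = s(a, c)) (hs₃ : (s(P X₃, P' X₃) : Sym2 V) = s(b, c)) :
    ∑ S ∈ (univ : Finset ι).powerset, ((∏ k ∈ S, θ k) * ∏ k ∈ univ \ S, (1 - θ k)) *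
        (if Δ ⊆ S then
          ((S.filter (fun X => X ∈ Cr ∧ ∀ Y ∈ S, P X = P Y ∨ P X = P' Y ∨ P' X = P Y ∨ P' X = P' Y)).card : ℝ)
         else 0) ≤ 3 * ∏ k ∈ Δ, θ k := by
  classical
  -- ports of a class from its port pair
  have hmem : ∀ (X : ι) (u w : V), (s(P X, P' X) : Sym2 V) = s(u, w) → ∀ Y : ι,
      (P Y = P X ∨ P Y = P' X ∨ P' Y = P X ∨ P' Y = P' X) → (P Y = u ∨ P Y = w ∨ P' Y = u ∨ P' Y = w) := by
    intro X u w h Y hY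
    have hports : ∀ q, (P X = q ∨ P' X = q) → q = u ∨ q = w := by
      intro q hq
      have : q ∈ (s(P X, P' X) : Sym2 V) := by rw [Sym2.mem_iff]; exact hq.imp Eq.symm Eq.symm
      rw [h, Sym2.mem_iff] at this
      exact this
    rcases hY with hY | hY | hY | hY
    · rcases hports (P Y) (Or.inl hY.symm) with h' | h'
      · exact Or.inl h'
      · exact Or.inr (Or.inl h')
    · rcases hports (P Y) (Or.inr hY.symm) with h' | h'
      · exact Or.inl h'
      · exact Or.inr (Or.inl h')
    · rcases hports (P' Y) (Or.inl hY.symm) with h' | h'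
      · exact Or.inr (Or.inr (Or.inl h'))
      · exact Or.inr (Or.inr (Or.inr h'))
    · rcases hports (P' Y) (Or.inr hY.symm) with h' | h'
      · exact Or.inr (Or.inr (Or.inl h'))
      · exact Or.inr (Or.inr (Or.inr h'))
  have hW0 : ∀ S : Finset ι, 0 ≤ (∏ k ∈ S, θ k) * ∏ k ∈ univ \ S, (1 - θ k) := fun S =>
    mul_nonneg (prod_nonneg fun k _ => hθ0 k) (prod_nonneg fun k _ => sub_nonneg.2 (hθ1 k))
  -- termwise: the count is ≤ 3 on `S ⊇ Δ`
  have hterm : ∀ S ∈ (univ : Finset ι).powerset,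
      ((∏ k ∈ S, θ k) * ∏ k ∈ univ \ S, (1 - θ k)) *
        (if Δ ⊆ S then
          ((S.filter (fun X => X ∈ Cr ∧ ∀ Y ∈ S, P X = P Y ∨ P X = P' Y ∨ P' X = P Y ∨ P' X = P' Y)).card : ℝ)
         else 0) ≤
      ((∏ k ∈ S, θ k) * ∏ k ∈ univ \ S, (1 - θ k)) * (if (Δ ⊆ S ∧ ∀ k ∈ (∅ : Finset ι), k ∉ S) then (3 : ℝ) else 0) := by
    intro S _
    refine mul_le_mul_of_nonneg_left ?_ (hW0 S)
    by_cases hΔ : Δ ⊆ S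
    · rw [if_pos hΔ, if_pos ⟨hΔ, fun k hk => absurd hk (Finset.notMem_empty k)⟩]
      have hcard := card_adjacent_triangle_le_three P P' hPP' hinj hab hac hbc
        (S.filter (fun X => X ∈ Cr ∧ ∀ Y ∈ S, P X = P Y ∨ P X = P' Y ∨ P' X = P Y ∨ P' X = P' Y))
        (fun X hX => by
          obtain ⟨-, -, hall⟩ := mem_filter.1 hX
          exact ⟨hmem X₁ a b hs₁ X (hall X₁ (hΔ h₁)), hmem X₂ a c hs₂ X (hall X₂ (hΔ h₂)),
            hmem X₃ b c hs₃ X (hall X₃ (hΔ h₃))⟩)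
      exact_mod_cast hcard
    · rw [if_neg hΔ, if_neg (fun h => hΔ h.1)]
  refine (sum_le_sum hterm).trans ?_
  have hcyl := cylinder_sum θ Δ ∅ (disjoint_empty_right Δ)
  rw [prod_empty, mul_one] at hcyl
  have h3 : ∀ S ∈ (univ : Finset ι).powerset,
      ((∏ k ∈ S, θ k) * ∏ k ∈ univ \ S, (1 - θ k)) * (if (Δ ⊆ S ∧ ∀ k ∈ (∅ : Finset ι), k ∉ S) then (3 : ℝ) else 0) =
      3 * (((∏ k ∈ S, θ k) * ∏ k ∈ univ \ S, (1 - θ k)) * (if (Δ ⊆ S ∧ ∀ k ∈ (∅ : Finset ι), k ∉ S) then (1 : ℝ) else 0)) := by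
    intro S _
    by_cases h : Δ ⊆ S ∧ ∀ k ∈ (∅ : Finset ι), k ∉ S
    · rw [if_pos h, if_pos h]; ring
    · rw [if_neg h, if_neg h]; ring
  rw [sum_congr rfl h3, ← mul_sum, hcyl]

/-- `p² ≤ xy` with `x, y ≥ 0` gives `2p ≤ x + y` (AM–GM without square roots). -/
theorem two_mul_le_add_of_sq_le_mul (x y p : ℝ) (hx : 0 ≤ x) (hy : 0 ≤ y) (h : p ^ 2 ≤ x * y) :
    2 * p ≤ x + y := by
  nlinarith [sq_nonneg (x - y), sq_nonneg (x + y - 2 * p)]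

/-- **Capacity of a triangle word (U1-PROOF §3, A0): `128 θ₁θ₂θ₃ ≤ Π O(rotation 1) + Π O(rotation 2)`.**  The rotations designate
complementary ports on each of the three classes (`O₁, O₁'` etc.), `O_{X,P}O_{X,P'} ≥ Φ_X²` and `Φ_X ≥ 4θ_X ≥ 0`. -/
theorem triangle_word_cap_ge (θ₁ θ₂ θ₃ Φ₁ Φ₂ Φ₃ O₁ O₁' O₂ O₂' O₃ O₃' : ℝ)
    (hθ₁ : 0 ≤ θ₁) (hθ₂ : 0 ≤ θ₂) (hθ₃ : 0 ≤ θ₃) (hΦ₁ : 4 * θ₁ ≤ Φ₁) (hΦ₂ : 4 * θ₂ ≤ Φ₂) (hΦ₃ : 4 * θ₃ ≤ Φ₃)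
    (hO₁ : 0 ≤ O₁) (hO₁' : 0 ≤ O₁') (hO₂ : 0 ≤ O₂) (hO₂' : 0 ≤ O₂') (hO₃ : 0 ≤ O₃) (hO₃' : 0 ≤ O₃')
    (h₁ : Φ₁ ^ 2 ≤ O₁ * O₁') (h₂ : Φ₂ ^ 2 ≤ O₂ * O₂') (h₃ : Φ₃ ^ 2 ≤ O₃ * O₃') :
    128 * (θ₁ * θ₂ * θ₃) ≤ O₁ * O₂ * O₃ + O₁' * O₂' * O₃' := by
  have hΦ₁0 : 0 ≤ Φ₁ := by linarith
  have hΦ₂0 : 0 ≤ Φ₂ := by linarith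
  have hΦ₃0 : 0 ≤ Φ₃ := by linarith
  -- `(Φ₁Φ₂Φ₃)² ≤ (O₁O₂O₃)(O₁'O₂'O₃')`
  have h12 : (Φ₁ * Φ₂) ^ 2 ≤ (O₁ * O₂) * (O₁' * O₂') := by
    have := mul_le_mul h₁ h₂ (sq_nonneg _) (mul_nonneg hO₁ hO₁')
    nlinarith
  have h123 : (Φ₁ * Φ₂ * Φ₃) ^ 2 ≤ (O₁ * O₂ * O₃) * (O₁' * O₂' * O₃') := by
    have := mul_le_mul h12 h₃ (sq_nonneg _) (mul_nonneg (mul_nonneg hO₁ hO₂) (mul_nonneg hO₁' hO₂'))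
    nlinarith
  have hamgm := two_mul_le_add_of_sq_le_mul (O₁ * O₂ * O₃) (O₁' * O₂' * O₃') (Φ₁ * Φ₂ * Φ₃)
    (mul_nonneg (mul_nonneg hO₁ hO₂) hO₃) (mul_nonneg (mul_nonneg hO₁' hO₂') hO₃') h123
  -- `64 θ₁θ₂θ₃ ≤ Φ₁Φ₂Φ₃`
  have h64 : 64 * (θ₁ * θ₂ * θ₃) ≤ Φ₁ * Φ₂ * Φ₃ := by
    have hA : 4 * θ₁ * (4 * θ₂) ≤ Φ₁ * Φ₂ := mul_le_mul hΦ₁ hΦ₂ (by linarith) hΦ₁0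
    have hB : 4 * θ₁ * (4 * θ₂) * (4 * θ₃) ≤ Φ₁ * Φ₂ * Φ₃ :=
      mul_le_mul hA hΦ₃ (by linarith) (mul_nonneg hΦ₁0 hΦ₂0)
    linarith
  linarith

end StarSet

end Summit.CriticalPhenomena.PercolationContinuityZ3.Theorems
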